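/-
Copyright: the b2b-balaban T⁴-continuum CRUX team, row NE7b OWNER lineage `t4-ne7b-p1` (gen 125). Project licence.
-/
import Summits.QuantumFields.BalabanUV.T4Continuum.Spine.NE7b.SupZdPerturbedCoarseForm
import Summits.QuantumFields.BalabanUV.T4Continuum.Spine.NE7b.SupZdKernelInverseLipschitz
import Summits.QuantumFields.BalabanUV.T4Continuum.Spine.NE7b.SupZdCoarseInverseLipschitz

/-!
# THE `H + K` COLUMN ON `ℤ^d` IS LIPSCHITZ IN THE POTENTIAL: for two potentials `V₁, V₂ : ℤ^d → [−λ, Λ]` with `|V₁ − V₂| ≤ D`, one kernel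
# `|K(p,q)| ≤ εe^{−γ|p−q|₁}` and ANY decaying perturbed block columns `Ψ^K_1` (of `H_{V₁} + K`) and `Ψ^K_2` (of `H_{V₂} + K`),
# `|Ψ^K_1 − Ψ^K_2| ≤ 2C_PK_{δ₀−μ}·D·C_Ψ·e^{−μ|blk n p − c|₁}`, the perturbed coarse operators obey `|T_{K,1} − T_{K,2}|(b,c) ≤ 2C_PK_{δ₀−μ}DC_Ψ
# e^{−μ|b−c|₁}`, and ANY decaying two-sided inverses `N₁` of `T_{K,1}`, `N₂` of `T_{K,2}` obey `|N₁ − N₂|(b,b′) ≤ C_N²·2C_PK_{δ₀−μ}DC_Ψ·K_{ν∕2}K_{ν∕4}·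
# e^{−(ν∕4)|b−b′|₁}` — the `V`-twin of (219)∕(223)'s Lipschitz dependence on `K`, stated for ANY objects with (222)'s displayed clauses so that
# every headline of the column ((222)∕(225)∕(232)∕(234)) feeds it by name; (216)'s profile lemma on the difference equation
# `(H_{V₁} + K)(Ψ^K_1 − Ψ^K_2) = (V₂ − V₁)Ψ^K_2`, (228)'s entrywise Lipschitz lemma and (202)'s double convolution
# (row NE7b, node U5c; (202)∕(216)∕(228)∕(234) BY NAME; [folklore])

Cell `pub-balaban`, sub-cell `t4`, spine estimate NE7b (`T4WeightBudget.RelWeightBound`; the cell's OWN estimate — NOT PRINTED in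
[Bałaban 1983–89], NOT PROVED).  Crux-route work under `Spine/NE7b/` by the row OWNER (`t4-ne7b-p1` gen 125, file (235)) under FREEZE
(0)'s crux-prover clause; NOTHING of Bałaban's is named as a Lean object, valued or asserted; no `T4Continuum/Support` leaf typed; no `def`,
no notation (`T_K(b,c) = (n+1)^{−d}Σ_{q ∈ B n b}Ψ^K_c(q)` WRITTEN OUT; the block columns and inverses are ANY families with the displayed
properties); zero `sorry`.  Imports (BY NAME): the OWNER's (234) `…SupZdPerturbedCoarseForm` (`coarse_entry_le`; through it (222) `K_pos`,
(216) `zd_perturbed_profile`, (189) `summable_kernel_row`, (191) `natAbs_sub_comm_sum`), (228) `…SupZdKernelInverseLipschitz`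
(`inverse_lipschitz`), (202) `…SupZdCoarseInverseLipschitz` (`double_conv`), Mathlib's `Summable.tsum_sub`, `Summable.tsum_prod`.

WHY (located).  The road's data is the background: every next-scale object must depend Lipschitz-continuously on the potential `V` (the
torus files (138)–(150), the `ℤ^d` files (184) `zd_solution_lipschitz_potential`, (192) `zd_coarse_entry_lipschitz`, (202)
`zd_coarse_inverse_lipschitz`, (210) `zd_response_lipschitz` did this for the LINEAR column).  For the `H + K` column ((216)–(234)) only the
dependence on `K` was quantified ((219)∕(223)∕(224)∕(225)).  The `V`-dependence is one subtraction: two perturbed block columns with the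
SAME kernel and block source satisfy `(H_{V₁} + K)(Ψ^K_{1,c} − Ψ^K_{2,c}) = (V₂ − V₁)·Ψ^K_{2,c}` — a source of block profile `D·C_Ψe^{−μ|blk n p − c|₁}`
— so (216)'s perturbed profile lemma (ANY bounded solution of the perturbed equation with a profile source keeps the profile, constant
`2C_PK_{δ₀−μ}`) bounds the difference with NO loss of rate; block means give `T_{K,1} − T_{K,2}`; and (228) (`N_A − N_B = N_A(B − A)N_B` with a
weight) with (202)'s double convolution turns the entry bound into `|N₁ − N₂| ≤ …e^{−(ν∕4)|b−b′|₁}`.  Stated for ANY objects with (222)'s displayed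
clauses: no constants need matching across headlines.

WHAT IS PROVED ([folklore]): §1 `perturbed_difference_equation` (the subtraction, with the kernel rows' summability); §2
**`zd_perturbed_column_lipschitz_potential`** (`∃ C₀ C_P δ₀ > 0` from `(d, a, λ, Λ)`: under (216)'s two smallness conditions, for ANY bounded
`Φ₁` solving the `V₁`-equations and ANY `Φ₂` of block profile `C_Φ` solving the `V₂`-equations: the column and coarse-entry bounds); §3
**`inverse_lipschitz_decay`** (kernel algebra: (228) with an exponentially decaying weight ⟹ a DECAYING Lipschitz bound, via (202)); §4 THE END
**`zd_perturbed_hessian_lipschitz_potential`** (columns, coarse operators AND their decaying inverses: the three bounds displayed); §5 toy.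

HONEST (what this is NOT).  Lipschitz bounds in the decay currency with the rate `ν∕4` for the inverses (no attempt at `ν`); the response
`h^K` and covariance `C_K`'s `V`-dependence are the by-name sequel ((223)∕(225)'s pattern); nothing of the torus; scalar skeleton ((A3),
NC-NE7b-α UNRULED); nothing of the covariant propagators of [B4]–[B6]; nothing of Bałaban's asserted.  BY-NAME EFFECT ON THE WALL: NONE.
NE7b NOT PRINTED ∕ NOT PROVED; spine PROVED 0∕9; rung (B)+1 — the programme's measures remain FINITE-torus statements; NOT the mass gap,
NOT Clay.  HONEST DEPENDENCY: continuum YM on T⁴ ⇐ BetaPertH ∧ nine spine estimates (0∕9 proved); BetaPertH ⇐ (D1) ∧ (D4) ∧ CAP+tail;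
G-an2-4 gates asym, D1 and NE2∕3∕4.
-/

set_option autoImplicit false

noncomputable section

namespace Summit.QuantumFields.BalabanUV.T4Continuum.NE7b.SupZdPerturbedPotentialLipschitz

open Real Filter Topology
open scoped ENNReal
open Literature.MathematicalPhysics.QuantumFieldTheory.Balaban1983to89
open B6QGQLower276 (X e blk B mem_B sum_B_const)
open SupZdExponentialSums (summable_kernel_row)
open SupZdCoarseForm (natAbs_sub_comm_sum)
open SupZdPerturbedColumn (K_pos)
open SupZdPerturbedCoarseEntries (zd_perturbed_profile)
open SupZdPerturbedCoarseForm (coarse_entry_le)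
open SupZdKernelInverseLipschitz (inverse_lipschitz)
open SupZdCoarseInverseLipschitz (double_conv)

variable {d : ℕ}

/-! ## §1. The difference of two perturbed solutions with the same kernel and source -/

/-- **THE DIFFERENCE EQUATION**: if `(H_{V₁} + K)Φ₁ = g` and `(H_{V₂} + K)Φ₂ = g` with `Φ₁, Φ₂` bounded and `K` of the class, then
`(H_{V₁} + K)(Φ₁ − Φ₂) = (V₂ − V₁)Φ₂` pointwise (the kernel rows converge absolutely). [folklore] -/
theorem perturbed_difference_equation (n : ℕ) (a : ℝ) {ε γ B₁ B₂ : ℝ} (hγ : 0 < γ) (V₁ V₂ : X d → ℝ) (K : X d → X d → ℝ)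
    (hK : ∀ p q, |K p q| ≤ ε * exp (-(γ * ∑ i, (((p i - q i).natAbs : ℕ) : ℝ)))) (Φ₁ Φ₂ g : X d → ℝ)
    (hΦ₁B : ∀ p, |Φ₁ p| ≤ B₁) (hΦ₂B : ∀ p, |Φ₂ p| ≤ B₂)
    (hΦ₁ : ∀ p, ((n : ℝ) + 1) ^ 2 * ∑ μ', (2 * Φ₁ p - Φ₁ (p + e μ') - Φ₁ (p - e μ'))
      + a / ((n : ℝ) + 1) ^ d * ∑ q ∈ B n (blk n p), Φ₁ q + V₁ p * Φ₁ p + ∑' q : X d, K p q * Φ₁ q = g p)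
    (hΦ₂ : ∀ p, ((n : ℝ) + 1) ^ 2 * ∑ μ', (2 * Φ₂ p - Φ₂ (p + e μ') - Φ₂ (p - e μ'))
      + a / ((n : ℝ) + 1) ^ d * ∑ q ∈ B n (blk n p), Φ₂ q + V₂ p * Φ₂ p + ∑' q : X d, K p q * Φ₂ q = g p) (p : X d) :
    ((n : ℝ) + 1) ^ 2 * ∑ μ', (2 * (Φ₁ p - Φ₂ p) - (Φ₁ (p + e μ') - Φ₂ (p + e μ')) - (Φ₁ (p - e μ') - Φ₂ (p - e μ')))
      + a / ((n : ℝ) + 1) ^ d * ∑ q ∈ B n (blk n p), (Φ₁ q - Φ₂ q) + V₁ p * (Φ₁ p - Φ₂ p)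
      + ∑' q : X d, K p q * (Φ₁ q - Φ₂ q) = (V₂ p - V₁ p) * Φ₂ p := by
  have s1 : Summable (fun q : X d => K p q * Φ₁ q) := summable_kernel_row hγ K hK Φ₁ hΦ₁B p
  have s2 : Summable (fun q : X d => K p q * Φ₂ q) := summable_kernel_row hγ K hK Φ₂ hΦ₂B p
  have e1 : ∑' q : X d, K p q * (Φ₁ q - Φ₂ q) = ∑' q : X d, K p q * Φ₁ q - ∑' q : X d, K p q * Φ₂ q := by
    rw [← s1.tsum_sub s2]; exact tsum_congr fun q => by ring
  have e2 : ∑ q ∈ B n (blk n p), (Φ₁ q - Φ₂ q) = ∑ q ∈ B n (blk n p), Φ₁ q - ∑ q ∈ B n (blk n p), Φ₂ q :=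
    Finset.sum_sub_distrib _ _
  have e3 : ∑ μ' : Fin d, (2 * (Φ₁ p - Φ₂ p) - (Φ₁ (p + e μ') - Φ₂ (p + e μ')) - (Φ₁ (p - e μ') - Φ₂ (p - e μ')))
      = ∑ μ', (2 * Φ₁ p - Φ₁ (p + e μ') - Φ₁ (p - e μ')) - ∑ μ', (2 * Φ₂ p - Φ₂ (p + e μ') - Φ₂ (p - e μ')) := by
    rw [← Finset.sum_sub_distrib]; exact Finset.sum_congr rfl fun μ' _ => by ring
  rw [e1, e2, e3]
  have h1 := hΦ₁ p
  have h2 := hΦ₂ p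
  linear_combination h1 - h2

/-! ## §2. The perturbed block columns and coarse entries are Lipschitz in the potential -/

/-- **THE PERTURBED COLUMN IS LIPSCHITZ IN `V`**: `d ≥ 3`, `a > 0`, `λ < min(2,a)`, `Λ ≥ 0` ⟹ `∃ C₀ C_P δ₀ > 0` ((216)'s) such that for ALL
`n`, potentials `V₁, V₂ : ℤ^d → [−λ, Λ]` with `|V₁ − V₂| ≤ D`, rates `0 < μ < min(δ₀, γ)`, sizes `ε ≥ 0` under (216)'s two smallness
conditions, kernels `|K(p,q)| ≤ εe^{−γ|p−q|₁}`, and ANY families `Φ₁` (bounded, solving the `V₁`-equations with block sources) and `Φ₂` (block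
profile `C_Φe^{−μ|blk n p − c|₁}`, solving the `V₂`-equations): `|Φ₁ − Φ₂|(c,p) ≤ 2C_PK_{δ₀−μ}·DC_Φ·e^{−μ|blk n p − c|₁}` and the coarse entries
differ by at most `2C_PK_{δ₀−μ}DC_Φe^{−μ|b−c|₁}` — §1 and (216)'s profile lemma for ANY bounded solution. [folklore] -/
theorem zd_perturbed_column_lipschitz_potential (hd : 3 ≤ d) (a : ℝ) (ha : 0 < a) {lam Lam : ℝ} (hlam : lam < min 2 a)
    (hLam : 0 ≤ Lam) :
    ∃ C₀ CP δ₀ : ℝ, 0 < C₀ ∧ 0 < CP ∧ 0 < δ₀ ∧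
    ∀ (n : ℕ) (V₁ V₂ : X d → ℝ), (∀ p, -lam ≤ V₁ p) → (∀ p, V₁ p ≤ Lam) → (∀ p, -lam ≤ V₂ p) → (∀ p, V₂ p ≤ Lam) →
    ∀ D : ℝ, (∀ p, |V₁ p - V₂ p| ≤ D) →
    ∀ (ε γ μ : ℝ), 0 ≤ ε → 0 < μ → μ < δ₀ → μ < γ →
      ε * (2 * (1 - exp (-γ))⁻¹) ^ d * C₀ ≤ 1 / 2 →
      (CP * (2 * (1 - exp (-(δ₀ - μ)))⁻¹) ^ d) * (ε * exp (μ * d) * (2 * (1 - exp (-(γ - μ)))⁻¹) ^ d) ≤ 1 / 2 →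
    ∀ (K : X d → X d → ℝ), (∀ p q, |K p q| ≤ ε * exp (-(γ * ∑ i, (((p i - q i).natAbs : ℕ) : ℝ)))) →
    ∀ (Φ₁ Φ₂ : X d → X d → ℝ) (B₁ CΦ : ℝ), (∀ c p, |Φ₁ c p| ≤ B₁) →
      (∀ c p, |Φ₂ c p| ≤ CΦ * exp (-(μ * ∑ i, (((blk n p i - c i).natAbs : ℕ) : ℝ)))) →
      (∀ c p, ((n : ℝ) + 1) ^ 2 * ∑ μ', (2 * Φ₁ c p - Φ₁ c (p + e μ') - Φ₁ c (p - e μ'))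
        + a / ((n : ℝ) + 1) ^ d * ∑ q ∈ B n (blk n p), Φ₁ c q + V₁ p * Φ₁ c p + ∑' q : X d, K p q * Φ₁ c q
          = if blk n p = c then 1 else 0) →
      (∀ c p, ((n : ℝ) + 1) ^ 2 * ∑ μ', (2 * Φ₂ c p - Φ₂ c (p + e μ') - Φ₂ c (p - e μ'))
        + a / ((n : ℝ) + 1) ^ d * ∑ q ∈ B n (blk n p), Φ₂ c q + V₂ p * Φ₂ c p + ∑' q : X d, K p q * Φ₂ c q
          = if blk n p = c then 1 else 0) →
      (∀ c p, |Φ₁ c p - Φ₂ c p| ≤ 2 * (CP * (2 * (1 - exp (-(δ₀ - μ)))⁻¹) ^ d) * (D * CΦ)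
          * exp (-(μ * ∑ i, (((blk n p i - c i).natAbs : ℕ) : ℝ)))) ∧
      (∀ b c, |(((n : ℝ) + 1) ^ d)⁻¹ * ∑ q ∈ B n b, Φ₁ c q - (((n : ℝ) + 1) ^ d)⁻¹ * ∑ q ∈ B n b, Φ₂ c q|
          ≤ 2 * (CP * (2 * (1 - exp (-(δ₀ - μ)))⁻¹) ^ d) * (D * CΦ) * exp (-(μ * ∑ i, (((b i - c i).natAbs : ℕ) : ℝ)))) := by
  classical
  obtain ⟨C₀, CP, δ₀, hC₀, hCP, hδ₀, H216⟩ := zd_perturbed_profile (d := d) hd a ha hlam hLam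
  refine ⟨C₀, CP, δ₀, hC₀, hCP, hδ₀, ?_⟩
  intro n V₁ V₂ hV₁ hV₁' hV₂ hV₂' D hD ε γ μ hε hμ hμδ hμγ hs1 hs2 K hK Φ₁ Φ₂ B₁ CΦ hΦ₁B hΦ₂B hΦ₁ hΦ₂
  have hγ : 0 < γ := hμ.trans hμγ
  have hCΦ : 0 ≤ CΦ := by
    have h := (abs_nonneg _).trans (hΦ₂B 0 0)
    exact le_of_mul_le_mul_right (by rw [zero_mul]; exact h) (exp_pos _)
  have hΦ₂b : ∀ c p, |Φ₂ c p| ≤ CΦ := fun c p =>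
    (hΦ₂B c p).trans (mul_le_of_le_one_right hCΦ (exp_le_one_iff.2 (by rw [neg_nonpos]; positivity)))
  have hP := (H216 n V₁ hV₁ hV₁' ε γ μ hε hμ hμδ hμγ hs1 hs2 K hK).2
  -- the column bound
  have hcol : ∀ c p, |Φ₁ c p - Φ₂ c p| ≤ 2 * (CP * (2 * (1 - exp (-(δ₀ - μ)))⁻¹) ^ d) * (D * CΦ)
      * exp (-(μ * ∑ i, (((blk n p i - c i).natAbs : ℕ) : ℝ))) := by
    intro c
    have hf : ∀ p, |(V₂ p - V₁ p) * Φ₂ c p| ≤ (D * CΦ) * exp (-(μ * ∑ i, (((blk n p i - c i).natAbs : ℕ) : ℝ))) := by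
      intro p
      rw [abs_mul, abs_sub_comm, mul_assoc]
      exact mul_le_mul (hD p) (hΦ₂B c p) (abs_nonneg _) ((abs_nonneg _).trans (hD p))
    have hwB : ∀ p, |Φ₁ c p - Φ₂ c p| ≤ B₁ + CΦ := fun p =>
      (abs_sub _ _).trans (add_le_add (hΦ₁B c p) (hΦ₂b c p))
    have hw : ∀ p, ((n : ℝ) + 1) ^ 2 * ∑ μ', (2 * (Φ₁ c p - Φ₂ c p) - (Φ₁ c (p + e μ') - Φ₂ c (p + e μ'))
        - (Φ₁ c (p - e μ') - Φ₂ c (p - e μ')))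
        + a / ((n : ℝ) + 1) ^ d * ∑ q ∈ B n (blk n p), (Φ₁ c q - Φ₂ c q) + V₁ p * (Φ₁ c p - Φ₂ c p)
        + ∑' q : X d, K p q * (Φ₁ c q - Φ₂ c q) = (V₂ p - V₁ p) * Φ₂ c p := fun p =>
      perturbed_difference_equation n a hγ V₁ V₂ K hK (Φ₁ c) (Φ₂ c) (fun p => if blk n p = c then 1 else 0)
        (hΦ₁B c) (hΦ₂b c) (hΦ₁ c) (hΦ₂ c) p
    exact hP c (D * CΦ) (fun p => (V₂ p - V₁ p) * Φ₂ c p) hf (fun p => Φ₁ c p - Φ₂ c p) (B₁ + CΦ) hwB hw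
  refine ⟨hcol, fun b c => ?_⟩
  have h := coarse_entry_le n (fun c p => Φ₁ c p - Φ₂ c p) c (hcol c) b
  have e : (((n : ℝ) + 1) ^ d)⁻¹ * ∑ q ∈ B n b, (Φ₁ c q - Φ₂ c q)
      = (((n : ℝ) + 1) ^ d)⁻¹ * ∑ q ∈ B n b, Φ₁ c q - (((n : ℝ) + 1) ^ d)⁻¹ * ∑ q ∈ B n b, Φ₂ c q := by
    rw [Finset.sum_sub_distrib, mul_sub]
  rw [e] at h
  exact h

/-! ## §3. Kernel algebra: a decaying Lipschitz bound for decaying inverses -/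

/-- **DECAYING INVERSES ARE LIPSCHITZ IN THE ENTRIES, WITH DECAY**: `A, B` bounded kernels on `ℤ^d`, `N_A` a decaying left inverse of `A`,
`N_B` a decaying right inverse of `B` (`|N_·(b,c)| ≤ C_Ne^{−ν|b−c|₁}`), and `|B − A|(c,c′) ≤ Le^{−ν|c−c′|₁}` ⟹
`|N_A(b,b′) − N_B(b,b′)| ≤ C_N²·L·K_{ν∕2}K_{ν∕4}·e^{−(ν∕4)|b−b′|₁}` — (228)'s weighted bound with the weight `Le^{−ν|c−c′|₁}` and (202)'s double
convolution. [folklore] -/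
theorem inverse_lipschitz_decay {CA Cn ν L : ℝ} (hCA : 0 ≤ CA) (hCn : 0 ≤ Cn) (hν : 0 < ν) (hL : 0 ≤ L) (A B NA NB : X d → X d → ℝ)
    (hA : ∀ c c', |A c c'| ≤ CA) (hB : ∀ c c', |B c c'| ≤ CA)
    (hNA : ∀ b c, |NA b c| ≤ Cn * exp (-(ν * ∑ i, (((b i - c i).natAbs : ℕ) : ℝ))))
    (hNB : ∀ b c, |NB b c| ≤ Cn * exp (-(ν * ∑ i, (((b i - c i).natAbs : ℕ) : ℝ))))
    (hNAA : ∀ b c', ∑' c : X d, NA b c * A c c' = if b = c' then 1 else 0)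
    (hBNB : ∀ c b', ∑' c' : X d, B c c' * NB c' b' = if c = b' then 1 else 0)
    (hAB : ∀ c c', |B c c' - A c c'| ≤ L * exp (-(ν * ∑ i, (((c i - c' i).natAbs : ℕ) : ℝ)))) (b b' : X d) :
    |NA b b' - NB b b'| ≤ Cn ^ 2 * (L * (2 * (1 - exp (-(ν / 2)))⁻¹) ^ d * (2 * (1 - exp (-(ν / 2 / 2)))⁻¹) ^ d)
      * exp (-(ν / 2 / 2 * ∑ i, (((b i - b' i).natAbs : ℕ) : ℝ))) := by
  classical
  obtain ⟨F, hF⟩ : ∃ F : X d → X d → ℝ, ∀ c c', F c c' = exp (-(ν * ∑ i, (((b i - c i).natAbs : ℕ) : ℝ)))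
      * (L * exp (-(ν * ∑ i, (((c i - c' i).natAbs : ℕ) : ℝ)))) * exp (-(ν * ∑ i, (((b' i - c' i).natAbs : ℕ) : ℝ))) :=
    ⟨_, fun _ _ => rfl⟩
  have hFb : ∀ c c', |F c c'| ≤ L * exp (-(ν * ∑ i, (((b i - c i).natAbs : ℕ) : ℝ)))
      * (exp (-(ν * ∑ i, (((c' i - b' i).natAbs : ℕ) : ℝ))) * exp (-(ν * ∑ i, (((c i - c' i).natAbs : ℕ) : ℝ)))) := by
    intro c c'
    rw [hF, abs_of_nonneg (by positivity), natAbs_sub_comm_sum b' c']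
    exact le_of_eq (by ring)
  obtain ⟨hsum, hbd⟩ := double_conv hν hL b b' F hFb
  have hsum' : Summable (fun x : X d × X d => exp (-(ν * ∑ i, (((b i - x.1 i).natAbs : ℕ) : ℝ)))
      * (L * exp (-(ν * ∑ i, (((x.1 i - x.2 i).natAbs : ℕ) : ℝ)))) * exp (-(ν * ∑ i, (((b' i - x.2 i).natAbs : ℕ) : ℝ)))) :=
    hsum.congr fun x => by show F x.1 x.2 = _; rw [hF]
  have h228 := (inverse_lipschitz hCA hCn hν A B NA NB hA hB hNA hNB hNAA hBNB b b').1
    (fun c c' => L * exp (-(ν * ∑ i, (((c i - c' i).natAbs : ℕ) : ℝ)))) hAB hsum'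
  have e : ∑' x : X d × X d, exp (-(ν * ∑ i, (((b i - x.1 i).natAbs : ℕ) : ℝ)))
      * (L * exp (-(ν * ∑ i, (((x.1 i - x.2 i).natAbs : ℕ) : ℝ)))) * exp (-(ν * ∑ i, (((b' i - x.2 i).natAbs : ℕ) : ℝ)))
      = ∑' c : X d, ∑' c' : X d, F c c' := by
    rw [show (fun x : X d × X d => exp (-(ν * ∑ i, (((b i - x.1 i).natAbs : ℕ) : ℝ)))
      * (L * exp (-(ν * ∑ i, (((x.1 i - x.2 i).natAbs : ℕ) : ℝ)))) * exp (-(ν * ∑ i, (((b' i - x.2 i).natAbs : ℕ) : ℝ))))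
      = Function.uncurry F from funext fun x => by show _ = F x.1 x.2; rw [hF], hsum.tsum_prod]
    rfl
  rw [e] at h228
  calc |NA b b' - NB b b'| ≤ Cn ^ 2 * ∑' c : X d, ∑' c' : X d, F c c' := h228
    _ ≤ Cn ^ 2 * (L * (2 * (1 - exp (-(ν / 2)))⁻¹) ^ d * (2 * (1 - exp (-(ν / 2 / 2)))⁻¹) ^ d
        * exp (-(ν / 2 / 2 * ∑ i, (((b i - b' i).natAbs : ℕ) : ℝ)))) :=
        mul_le_mul_of_nonneg_left ((le_abs_self _).trans hbd) (sq_nonneg _)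
    _ = _ := by ring

/-! ## §4. THE END: the perturbed next-scale Hessian is Lipschitz in the potential -/

/-- **HEADLINE — THE `H + K` COLUMN'S NEXT-SCALE HESSIAN IS LIPSCHITZ IN THE POTENTIAL.**  `d ≥ 3`, `a > 0`, `λ < min(2,a)`, `Λ ≥ 0` ⟹
`∃ C₀ C_P δ₀ > 0` (from `(d, a, λ, Λ)` ONLY) such that for ALL `n`, potentials `V₁, V₂ : ℤ^d → [−λ, Λ]` with `|V₁ − V₂| ≤ D`, rates
`0 < ν < μ < min(δ₀, γ)`, `ε ≥ 0` under (216)'s two smallness conditions, kernels `|K(p,q)| ≤ εe^{−γ|p−q|₁}`, and ANY perturbed block columns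
`Ψ^K_1, Ψ^K_2` (block profile `C_Ψe^{−μ|blk n p − c|₁}`; the `V₁`- resp. `V₂`-equations with block sources — (222) (A) for each potential) with
ANY decaying kernels `N₁, N₂` (`|N_j(b,c)| ≤ C_Ne^{−ν|b−c|₁}`; `N₁` a LEFT inverse of `T_{K,1}`, `N₂` a RIGHT inverse of `T_{K,2}` — (222) (C)):
(i) `|Ψ^K_1 − Ψ^K_2|(c,p) ≤ 2C_PK_{δ₀−μ}DC_Ψe^{−μ|blk n p − c|₁}`; (ii) `|T_{K,1} − T_{K,2}|(b,c) ≤ 2C_PK_{δ₀−μ}DC_Ψe^{−μ|b−c|₁}`; (iii)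
`|N₁ − N₂|(b,b′) ≤ C_N²·2C_PK_{δ₀−μ}DC_Ψ·K_{ν∕2}K_{ν∕4}·e^{−(ν∕4)|b−b′|₁}` — §2 and §3 (`|T_{K,j}| ≤ C_Ψ`, `e^{−μ} ≤ e^{−ν}`). [folklore] -/
theorem zd_perturbed_hessian_lipschitz_potential (hd : 3 ≤ d) (a : ℝ) (ha : 0 < a) {lam Lam : ℝ} (hlam : lam < min 2 a)
    (hLam : 0 ≤ Lam) :
    ∃ C₀ CP δ₀ : ℝ, 0 < C₀ ∧ 0 < CP ∧ 0 < δ₀ ∧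
    ∀ (n : ℕ) (V₁ V₂ : X d → ℝ), (∀ p, -lam ≤ V₁ p) → (∀ p, V₁ p ≤ Lam) → (∀ p, -lam ≤ V₂ p) → (∀ p, V₂ p ≤ Lam) →
    ∀ D : ℝ, (∀ p, |V₁ p - V₂ p| ≤ D) →
    ∀ (ε γ μ ν : ℝ), 0 ≤ ε → 0 < μ → μ < δ₀ → μ < γ → 0 < ν → ν < μ →
      ε * (2 * (1 - exp (-γ))⁻¹) ^ d * C₀ ≤ 1 / 2 →
      (CP * (2 * (1 - exp (-(δ₀ - μ)))⁻¹) ^ d) * (ε * exp (μ * d) * (2 * (1 - exp (-(γ - μ)))⁻¹) ^ d) ≤ 1 / 2 →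
    ∀ (K : X d → X d → ℝ), (∀ p q, |K p q| ≤ ε * exp (-(γ * ∑ i, (((p i - q i).natAbs : ℕ) : ℝ)))) →
    ∀ (ΨK₁ ΨK₂ : X d → X d → ℝ) (CΨ : ℝ),
      (∀ c p, |ΨK₁ c p| ≤ CΨ * exp (-(μ * ∑ i, (((blk n p i - c i).natAbs : ℕ) : ℝ)))) →
      (∀ c p, |ΨK₂ c p| ≤ CΨ * exp (-(μ * ∑ i, (((blk n p i - c i).natAbs : ℕ) : ℝ)))) →
      (∀ c p, ((n : ℝ) + 1) ^ 2 * ∑ μ', (2 * ΨK₁ c p - ΨK₁ c (p + e μ') - ΨK₁ c (p - e μ'))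
        + a / ((n : ℝ) + 1) ^ d * ∑ q ∈ B n (blk n p), ΨK₁ c q + V₁ p * ΨK₁ c p + ∑' q : X d, K p q * ΨK₁ c q
          = if blk n p = c then 1 else 0) →
      (∀ c p, ((n : ℝ) + 1) ^ 2 * ∑ μ', (2 * ΨK₂ c p - ΨK₂ c (p + e μ') - ΨK₂ c (p - e μ'))
        + a / ((n : ℝ) + 1) ^ d * ∑ q ∈ B n (blk n p), ΨK₂ c q + V₂ p * ΨK₂ c p + ∑' q : X d, K p q * ΨK₂ c q
          = if blk n p = c then 1 else 0) →
    ∀ (N₁ N₂ : X d → X d → ℝ) (CN : ℝ), 0 ≤ CN →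
      (∀ b c, |N₁ b c| ≤ CN * exp (-(ν * ∑ i, (((b i - c i).natAbs : ℕ) : ℝ)))) →
      (∀ b c, |N₂ b c| ≤ CN * exp (-(ν * ∑ i, (((b i - c i).natAbs : ℕ) : ℝ)))) →
      (∀ b c, ∑' b' : X d, N₁ b b' * ((((n : ℝ) + 1) ^ d)⁻¹ * ∑ q ∈ B n b', ΨK₁ c q) = if b = c then 1 else 0) →
      (∀ b c, ∑' b' : X d, ((((n : ℝ) + 1) ^ d)⁻¹ * ∑ q ∈ B n b, ΨK₂ b' q) * N₂ b' c = if b = c then 1 else 0) →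
      (∀ c p, |ΨK₁ c p - ΨK₂ c p| ≤ 2 * (CP * (2 * (1 - exp (-(δ₀ - μ)))⁻¹) ^ d) * (D * CΨ)
          * exp (-(μ * ∑ i, (((blk n p i - c i).natAbs : ℕ) : ℝ)))) ∧
      (∀ b c, |(((n : ℝ) + 1) ^ d)⁻¹ * ∑ q ∈ B n b, ΨK₁ c q - (((n : ℝ) + 1) ^ d)⁻¹ * ∑ q ∈ B n b, ΨK₂ c q|
          ≤ 2 * (CP * (2 * (1 - exp (-(δ₀ - μ)))⁻¹) ^ d) * (D * CΨ) * exp (-(μ * ∑ i, (((b i - c i).natAbs : ℕ) : ℝ)))) ∧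
      (∀ b b', |N₁ b b' - N₂ b b'| ≤ CN ^ 2 * ((2 * (CP * (2 * (1 - exp (-(δ₀ - μ)))⁻¹) ^ d) * (D * CΨ))
          * (2 * (1 - exp (-(ν / 2)))⁻¹) ^ d * (2 * (1 - exp (-(ν / 2 / 2)))⁻¹) ^ d)
          * exp (-(ν / 2 / 2 * ∑ i, (((b i - b' i).natAbs : ℕ) : ℝ)))) := by
  classical
  obtain ⟨C₀, CP, δ₀, hC₀, hCP, hδ₀, H2⟩ := zd_perturbed_column_lipschitz_potential (d := d) hd a ha hlam hLam
  refine ⟨C₀, CP, δ₀, hC₀, hCP, hδ₀, ?_⟩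
  intro n V₁ V₂ hV₁ hV₁' hV₂ hV₂' D hD ε γ μ ν hε hμ hμδ hμγ hν hνμ hs1 hs2 K hK ΨK₁ ΨK₂ CΨ hΨ₁B hΨ₂B hΨ₁ hΨ₂
    N₁ N₂ CN hCN hN₁ hN₂ hN₁T hTN₂
  have hCΨ : 0 ≤ CΨ := by
    have h := (abs_nonneg _).trans (hΨ₂B 0 0)
    exact le_of_mul_le_mul_right (by rw [zero_mul]; exact h) (exp_pos _)
  have hD0 : 0 ≤ D := (abs_nonneg _).trans (hD 0)
  have hK0 : 0 < (2 * (1 - exp (-(δ₀ - μ)))⁻¹) ^ d := K_pos (d := d) (sub_pos.2 hμδ)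
  have hΨ₁b : ∀ c p, |ΨK₁ c p| ≤ CΨ := fun c p =>
    (hΨ₁B c p).trans (mul_le_of_le_one_right hCΨ (exp_le_one_iff.2 (by rw [neg_nonpos]; positivity)))
  obtain ⟨hcol, hT⟩ := H2 n V₁ V₂ hV₁ hV₁' hV₂ hV₂' D hD ε γ μ hε hμ hμδ hμγ hs1 hs2 K hK ΨK₁ ΨK₂ CΨ CΨ hΨ₁b hΨ₂B hΨ₁ hΨ₂
  refine ⟨hcol, hT, fun b b' => ?_⟩
  -- the two coarse operators as bounded kernels, their difference with rate `ν`
  obtain ⟨T₁, hT₁⟩ : ∃ T₁ : X d → X d → ℝ, ∀ b c, T₁ b c = (((n : ℝ) + 1) ^ d)⁻¹ * ∑ q ∈ B n b, ΨK₁ c q := ⟨_, fun _ _ => rfl⟩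
  obtain ⟨T₂, hT₂⟩ : ∃ T₂ : X d → X d → ℝ, ∀ b c, T₂ b c = (((n : ℝ) + 1) ^ d)⁻¹ * ∑ q ∈ B n b, ΨK₂ c q := ⟨_, fun _ _ => rfl⟩
  have hTb : ∀ (Φ : X d → X d → ℝ), (∀ c p, |Φ c p| ≤ CΨ * exp (-(μ * ∑ i, (((blk n p i - c i).natAbs : ℕ) : ℝ)))) →
      ∀ b c, |(((n : ℝ) + 1) ^ d)⁻¹ * ∑ q ∈ B n b, Φ c q| ≤ CΨ := fun Φ hΦ b c =>
    (coarse_entry_le n Φ c (hΦ c) b).trans (mul_le_of_le_one_right hCΨ (exp_le_one_iff.2 (by rw [neg_nonpos]; positivity)))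
  have hA : ∀ b c, |T₁ b c| ≤ CΨ := fun b c => by rw [hT₁]; exact hTb ΨK₁ hΨ₁B b c
  have hB : ∀ b c, |T₂ b c| ≤ CΨ := fun b c => by rw [hT₂]; exact hTb ΨK₂ hΨ₂B b c
  have hAB : ∀ c c', |T₂ c c' - T₁ c c'| ≤ (2 * (CP * (2 * (1 - exp (-(δ₀ - μ)))⁻¹) ^ d) * (D * CΨ))
      * exp (-(ν * ∑ i, (((c i - c' i).natAbs : ℕ) : ℝ))) := by
    intro c c'
    rw [abs_sub_comm, hT₁, hT₂]
    refine (hT c c').trans (mul_le_mul_of_nonneg_left (exp_le_exp.2 ?_) (by positivity))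
    have h0 : (0 : ℝ) ≤ ∑ i, (((c i - c' i).natAbs : ℕ) : ℝ) := by positivity
    nlinarith
  have hN₁T' : ∀ b c', ∑' c : X d, N₁ b c * T₁ c c' = if b = c' then 1 else 0 := fun b c' => by
    simp only [hT₁]; exact hN₁T b c'
  have hTN₂' : ∀ c b', ∑' c' : X d, T₂ c c' * N₂ c' b' = if c = b' then 1 else 0 := fun c b' => by
    simp only [hT₂]; exact hTN₂ c b'
  exact inverse_lipschitz_decay hCΨ hCN hν (by positivity) T₁ T₂ N₁ N₂ hA hB hN₁ hN₂ hN₁T' hTN₂' hAB b b'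

/-! ## §5. Toy -/

/-- Toy (`d = 3`, `a = 1`, `λ = 0`, `Λ = 1`): the three constants exist. -/
example : ∃ C₀ CP δ₀ : ℝ, 0 < C₀ ∧ 0 < CP ∧ 0 < δ₀ :=
  let ⟨C₀, CP, δ₀, h1, h2, h3, _⟩ :=
    zd_perturbed_hessian_lipschitz_potential (d := 3) le_rfl 1 one_pos (lam := 0) (Lam := 1)
      (by rw [min_eq_right (by norm_num : (1 : ℝ) ≤ 2)]; norm_num) zero_le_one
  ⟨C₀, CP, δ₀, h1, h2, h3⟩

end Summit.QuantumFields.BalabanUV.T4Continuum.NE7b.SupZdPerturbedPotentialLipschitz
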